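import Mathlib
import HarnessLib
import Summits.Ventures.LatticeQCDFlow.Scoring.GaussianStudentEventReduction
import Summits.Ventures.LatticeQCDFlow.Scoring.GaussianShiftedSectionProduct

/-!
# THE FIXED-COUNT (STUDENT-TYPE) CRITERIA UNDER A DRIFT ARE SHIFTED CONES: ROW 4's ONE-RUN EVENT
# `{a(ḡ + δ)² ≤ t² s²(g)}` AND TWO-ARM EVENT `{a(ḡ − h̄ + δ)² ≤ t²(s²(g) + s²(h))}` UNDER THE
# GAUSSIAN PRODUCTS EQUAL `(N(0,1) ⊗ N^{⊗m}){(u + κ)² ≤ t² Σ_j w_j²/m}` WITH `κ = δ√a`, RESP.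
# `κ = δ√a/√2` AND `m = a − 1`, RESP. `2a − 2` — HENCE THEIR PROBABILITY IS EVEN IN `δ`,
# NON-INCREASING IN `|δ|`, CONTINUOUS, `→ 0`, AND STRICTLY DECREASING (`t > 0`)
# (textbook: the non-central `t` acceptance probability decreases in the non-centrality)

HONEST FRAMING: exact (Metropolis-corrected) sampling algorithms for lattice gauge theory;
figures of merit are autocorrelation/cost numbers at stated couplings and volumes; no
continuum-physics claim.

Venture `LatticeQCDFlow` (cell pub-lqcd), topic `Scoring`; FANOUT row 4 (`s0-u1-b`, GEN-34).
NEW WORK of the cell (classical), no definition, nothing cited as a fact (the non-central `t` law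
NAMED ONLY).

WHY (row 4).  With a FIXED number `a` of batches / replicas per arm, row 4's criteria have
Student-type limits (GEN-32 `BatchMeansFixedBatchCount`, `BatchMeansTwoChainFixedBatchCount`,
row 13's replica bars), reduced EXACTLY to Student-ratio events by
`Scoring/GaussianStudentEventReduction` (Helmert per arm).  Under a local alternative the limit
Gaussian vector of batch means is shifted by a drift `δ` (in units of the per-batch standard
deviation), and the acceptance event becomes `{a(ḡ + δ)² ≤ t² s²(g)}` (one run against the truth)
or `{a(ḡ − h̄ + δ)² ≤ t²(s²(g) + s²(h))}` (A vs B).  This file runs the SAME Helmert reduction with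
the drift carried along — it only moves the head coordinate — landing in the shifted-CONE form
`{(u + κ)² ≤ g(w)}`, `g(w) = t² Σ_j w_j²/m`, on `N(0,1) ⊗ N(0,1)^{⊗m}`
(**`pi_gaussianReal_student_shift_eq_prod`**, **`pi_gaussianReal_twoSample_student_shift_eq_prod`**),
where `Scoring/GaussianShiftedSectionProduct` supplies all operating facts: the fixed-count
criteria's limiting pass probability under a drift is even in `δ`, NON-INCREASING in `|δ|`
(**`pi_gaussianReal_student_shift_antitoneOn`**, **`…twoSample…`**), continuous, tends to `0` as
`δ → ∞`, and is STRICTLY decreasing for `t > 0` (the Gaussian product charges `{Σ w_j² > 0}`).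

NOT CLAIMED: the detectable drift (separate file `Scoring/GaussianStudentShiftThreshold`); the chain-level drifted fixed-count theorems (they follow the GEN-32 chain once it is
built, with the drifted limit vector); monotonicity in `a` under a drift; numerical values.
-/

open MeasureTheory ProbabilityTheory Filter Topology Finset
open scoped ENNReal

namespace Summit.Ventures.LatticeQCDFlow.Scoring

open Set WithLp
open scoped RealInnerProductSpace

/-! ## §1 Splitting off the head coordinate -/

section Split

/-- `N(0,1)^{⊗(m+1)}{z | (z₀, (z_{j+1})_j) ∈ B} = (N(0,1) ⊗ N(0,1)^{⊗m})(B)` for Borel `B`. [ours] -/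
theorem pi_gaussianReal_split_eq_prod (m : ℕ) {B : Set (ℝ × (Fin m → ℝ))} (hB : MeasurableSet B) :
    (Measure.pi fun _ : Fin (m + 1) => gaussianReal 0 1)
        {z : Fin (m + 1) → ℝ | (z 0, fun j : Fin m => z j.succ) ∈ B}
      = ((gaussianReal 0 1).prod (Measure.pi fun _ : Fin m => gaussianReal 0 1)) B := by
  have hmp := measurePreserving_piFinSuccAbove (fun _ : Fin (m + 1) => gaussianReal 0 1) 0
  have hA : {z : Fin (m + 1) → ℝ | (z 0, fun j : Fin m => z j.succ) ∈ B}
      = MeasurableEquiv.piFinSuccAbove (fun _ : Fin (m + 1) => ℝ) 0 ⁻¹' B := by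
    ext z
    simp only [Set.mem_setOf_eq, Set.mem_preimage, MeasurableEquiv.piFinSuccAbove_apply,
      Fin.insertNthEquiv, Equiv.coe_fn_symm_mk, Fin.removeNth_zero]
    exact Iff.rfl
  rw [hA, ← Measure.map_apply (MeasurableEquiv.measurable _) hB, hmp.map_eq]

/-- The cone threshold `w ↦ t² (Σ_j w_j²)/m` is measurable. -/
theorem measurable_coneThreshold (t : ℝ) (m : ℕ) :
    Measurable fun w : Fin m → ℝ => t ^ 2 * (∑ j, w j ^ 2) / (m : ℝ) := by fun_prop

/-- The Gaussian product charges the cone's interior `{w | 0 < t² (Σ_j w_j²)/m}` (`t ≠ 0`, `m ≥ 1`). -/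
theorem pi_gaussianReal_coneThreshold_pos {t : ℝ} (ht : t ≠ 0) {m : ℕ} (hm : 1 ≤ m) :
    (Measure.pi fun _ : Fin m => gaussianReal 0 1)
      {w : Fin m → ℝ | 0 < t ^ 2 * (∑ j, w j ^ 2) / (m : ℝ)} ≠ 0 := by
  haveI : ∀ _i : Fin m, (gaussianReal (0 : ℝ) 1).IsOpenPosMeasure := fun _ =>
    (gaussianReal_absolutelyContinuous' 0 one_ne_zero).isOpenPosMeasure
  have hcont : Continuous fun w : Fin m → ℝ => t ^ 2 * (∑ j, w j ^ 2) / (m : ℝ) := by fun_prop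
  have hopen : IsOpen {w : Fin m → ℝ | 0 < t ^ 2 * (∑ j, w j ^ 2) / (m : ℝ)} :=
    isOpen_lt continuous_const hcont
  have hne : ({w : Fin m → ℝ | 0 < t ^ 2 * (∑ j, w j ^ 2) / (m : ℝ)}).Nonempty := by
    refine ⟨fun _ => 1, ?_⟩
    simp only [Set.mem_setOf_eq, one_pow, Finset.sum_const, Finset.card_univ, Fintype.card_fin,
      nsmul_eq_mul, mul_one]
    have hm' : (0 : ℝ) < m := by exact_mod_cast hm
    have ht2 : 0 < t ^ 2 := by positivity
    rw [mul_div_assoc, div_self hm'.ne', mul_one]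
    exact ht2
  exact (hopen.measure_pos (Measure.pi fun _ : Fin m => gaussianReal 0 1) hne).ne'

end Split

/-! ## §2 One run against the truth: `{a(ḡ + δ)² ≤ t² s²(g)}` -/

section OneSample

/-- **The drifted one-sample fixed-count event is a shifted cone**: for `a = n + 1 ≥ 1` batches,
every `t` and drift `δ`,
`N(0,1)^{⊗a}{g | a(ḡ + δ)² ≤ t² s²(g)} = (N(0,1) ⊗ N(0,1)^{⊗n}){(u, w) | (u + δ√a)² ≤ t² (Σ_j w_j²)/n}`
(Helmert: `(O g)₀ = √a ḡ`, `Σ_{r≠0} (O g)_r² = (a−1) s²(g)`; the drift moves the head only). [ours] -/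
theorem pi_gaussianReal_student_shift_eq_prod (t δ : ℝ) (n : ℕ) :
    (Measure.pi fun _ : Fin (n + 1) => gaussianReal 0 1)
        {g : Fin (n + 1) → ℝ | ((n + 1 : ℕ) : ℝ) * ((∑ i, g i) / ((n + 1 : ℕ) : ℝ) + δ) ^ 2
          ≤ t ^ 2 * ((∑ j, (g j - (∑ i, g i) / ((n + 1 : ℕ) : ℝ)) ^ 2) / (((n + 1 : ℕ) : ℝ) - 1))}
      = ((gaussianReal 0 1).prod (Measure.pi fun _ : Fin n => gaussianReal 0 1))
        {p : ℝ × (Fin n → ℝ) | (p.1 + δ * Real.sqrt ((n + 1 : ℕ) : ℝ)) ^ 2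
          ≤ t ^ 2 * (∑ j, p.2 j ^ 2) / (n : ℝ)} := by
  set O := ((ℝ ∙ ((toLp 2 (fun _ : Fin (n + 1) => (Real.sqrt (Fintype.card (Fin (n + 1))))⁻¹)
      : EuclideanSpace ℝ (Fin (n + 1))) - EuclideanSpace.single 0 (1 : ℝ)))ᗮ).reflection with hO
  set Ψ : (Fin (n + 1) → ℝ) → (Fin (n + 1) → ℝ) := fun z => ofLp (O (toLp 2 z)) with hΨ
  have hmp : MeasurePreserving Ψ (Measure.pi fun _ : Fin (n + 1) => gaussianReal 0 1)
      (Measure.pi fun _ : Fin (n + 1) => gaussianReal 0 1) := by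
    have := measurePreserving_helmert_pi (ι := Fin (n + 1)) 0
    rwa [← hO] at this
  have ha : (0 : ℝ) < ((n + 1 : ℕ) : ℝ) := by positivity
  have ha1 : ((n + 1 : ℕ) : ℝ) - 1 = (n : ℝ) := by push_cast; ring
  obtain ⟨hhead, htail⟩ := helmert_head_tail n
  rw [← hO] at hhead htail
  set B : Set (ℝ × (Fin n → ℝ)) := {p | (p.1 + δ * Real.sqrt ((n + 1 : ℕ) : ℝ)) ^ 2
      ≤ t ^ 2 * (∑ j, p.2 j ^ 2) / (n : ℝ)} with hB
  have hBm : MeasurableSet B := measurableSet_le (by fun_prop) (by fun_prop)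
  have hCm : MeasurableSet {z : Fin (n + 1) → ℝ | (z 0, fun j : Fin n => z j.succ) ∈ B} := by
    simp only [hB, Set.mem_setOf_eq]
    exact measurableSet_le (by fun_prop) (by fun_prop)
  have hpre : {g : Fin (n + 1) → ℝ | ((n + 1 : ℕ) : ℝ) * ((∑ i, g i) / ((n + 1 : ℕ) : ℝ) + δ) ^ 2
          ≤ t ^ 2 * ((∑ j, (g j - (∑ i, g i) / ((n + 1 : ℕ) : ℝ)) ^ 2) / (((n + 1 : ℕ) : ℝ) - 1))}
      = Ψ ⁻¹' {z : Fin (n + 1) → ℝ | (z 0, fun j : Fin n => z j.succ) ∈ B} := by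
    ext g
    simp only [Set.mem_setOf_eq, Set.mem_preimage, hB]
    rw [show Ψ g 0 = _ from hhead g, show ∑ j : Fin n, Ψ g j.succ ^ 2 = _ from htail g, ha1]
    set S := ∑ i, g i
    set R := ∑ j, (g j - S / ((n + 1 : ℕ) : ℝ)) ^ 2
    have hsa : Real.sqrt ((n + 1 : ℕ) : ℝ) ≠ 0 := (Real.sqrt_pos.2 ha).ne'
    have key : (S / Real.sqrt ((n + 1 : ℕ) : ℝ) + δ * Real.sqrt ((n + 1 : ℕ) : ℝ)) ^ 2
        = ((n + 1 : ℕ) : ℝ) * (S / ((n + 1 : ℕ) : ℝ) + δ) ^ 2 := by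
      have h1 : S / Real.sqrt ((n + 1 : ℕ) : ℝ) + δ * Real.sqrt ((n + 1 : ℕ) : ℝ)
          = Real.sqrt ((n + 1 : ℕ) : ℝ) * (S / ((n + 1 : ℕ) : ℝ) + δ) := by
        field_simp
        rw [Real.sq_sqrt ha.le]
        ring
      rw [h1, mul_pow, Real.sq_sqrt ha.le]
    rw [key, mul_div_assoc]
  rw [hpre, ← Measure.map_apply hmp.measurable hCm, hmp.map_eq, pi_gaussianReal_split_eq_prod n hBm]

/-- **Monotone in the drift**: `δ ↦ N^{⊗a}{a(ḡ + δ)² ≤ t² s²(g)}` is non-increasing on `[0, ∞)`. [ours] -/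
theorem pi_gaussianReal_student_shift_antitoneOn (t : ℝ) (n : ℕ) :
    AntitoneOn (fun δ : ℝ => (Measure.pi fun _ : Fin (n + 1) => gaussianReal 0 1).real
      {g : Fin (n + 1) → ℝ | ((n + 1 : ℕ) : ℝ) * ((∑ i, g i) / ((n + 1 : ℕ) : ℝ) + δ) ^ 2
        ≤ t ^ 2 * ((∑ j, (g j - (∑ i, g i) / ((n + 1 : ℕ) : ℝ)) ^ 2) / (((n + 1 : ℕ) : ℝ) - 1))})
      (Ici 0) := by
  intro δ hδ δ' hδ' hle
  simp only [measureReal_def, pi_gaussianReal_student_shift_eq_prod]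
  have ha : 0 ≤ Real.sqrt ((n + 1 : ℕ) : ℝ) := Real.sqrt_nonneg _
  have e1 : (0 : ℝ) ≤ δ * Real.sqrt ((n + 1 : ℕ) : ℝ) := mul_nonneg (Set.mem_Ici.1 hδ) ha
  have e2 : (0 : ℝ) ≤ δ' * Real.sqrt ((n + 1 : ℕ) : ℝ) := mul_nonneg (Set.mem_Ici.1 hδ') ha
  have e3 : δ * Real.sqrt ((n + 1 : ℕ) : ℝ) ≤ δ' * Real.sqrt ((n + 1 : ℕ) : ℝ) :=
    mul_le_mul_of_nonneg_right hle ha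
  have h := prod_shiftedSection_antitoneOn (ν := Measure.pi fun _ : Fin n => gaussianReal 0 1)
    (measurable_coneThreshold t n) (Set.mem_Ici.2 e1) (Set.mem_Ici.2 e2) e3
  simp only [measureReal_def] at h
  exact h

/-- **Even in the drift.** [ours] -/
theorem pi_gaussianReal_student_shift_neg (t δ : ℝ) (n : ℕ) :
    (Measure.pi fun _ : Fin (n + 1) => gaussianReal 0 1)
      {g : Fin (n + 1) → ℝ | ((n + 1 : ℕ) : ℝ) * ((∑ i, g i) / ((n + 1 : ℕ) : ℝ) + -δ) ^ 2
        ≤ t ^ 2 * ((∑ j, (g j - (∑ i, g i) / ((n + 1 : ℕ) : ℝ)) ^ 2) / (((n + 1 : ℕ) : ℝ) - 1))}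
      = (Measure.pi fun _ : Fin (n + 1) => gaussianReal 0 1)
      {g : Fin (n + 1) → ℝ | ((n + 1 : ℕ) : ℝ) * ((∑ i, g i) / ((n + 1 : ℕ) : ℝ) + δ) ^ 2
        ≤ t ^ 2 * ((∑ j, (g j - (∑ i, g i) / ((n + 1 : ℕ) : ℝ)) ^ 2) / (((n + 1 : ℕ) : ℝ) - 1))} := by
  rw [pi_gaussianReal_student_shift_eq_prod, pi_gaussianReal_student_shift_eq_prod, neg_mul]
  exact prod_shiftedSection_neg (measurable_coneThreshold t n) _

/-- **Continuous in the drift and `→ 0` as `δ → ∞`.** [ours] -/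
theorem continuous_pi_gaussianReal_student_shift (t : ℝ) (n : ℕ) :
    Continuous fun δ : ℝ => (Measure.pi fun _ : Fin (n + 1) => gaussianReal 0 1).real
      {g : Fin (n + 1) → ℝ | ((n + 1 : ℕ) : ℝ) * ((∑ i, g i) / ((n + 1 : ℕ) : ℝ) + δ) ^ 2
        ≤ t ^ 2 * ((∑ j, (g j - (∑ i, g i) / ((n + 1 : ℕ) : ℝ)) ^ 2) / (((n + 1 : ℕ) : ℝ) - 1))} := by
  simp only [measureReal_def, pi_gaussianReal_student_shift_eq_prod]
  have h := continuous_prod_shiftedSection (ν := Measure.pi fun _ : Fin n => gaussianReal 0 1)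
    (measurable_coneThreshold t n)
  simp only [measureReal_def] at h
  exact h.comp (continuous_id.mul continuous_const)

/-- **`→ 0` as the drift `δ → ∞`** (one run). [ours] -/
theorem tendsto_pi_gaussianReal_student_shift_atTop (t : ℝ) (n : ℕ) :
    Tendsto (fun δ : ℝ => (Measure.pi fun _ : Fin (n + 1) => gaussianReal 0 1).real
      {g : Fin (n + 1) → ℝ | ((n + 1 : ℕ) : ℝ) * ((∑ i, g i) / ((n + 1 : ℕ) : ℝ) + δ) ^ 2
        ≤ t ^ 2 * ((∑ j, (g j - (∑ i, g i) / ((n + 1 : ℕ) : ℝ)) ^ 2) / (((n + 1 : ℕ) : ℝ) - 1))})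
      atTop (𝓝 0) := by
  simp only [measureReal_def, pi_gaussianReal_student_shift_eq_prod]
  have h := tendsto_prod_shiftedSection_atTop (ν := Measure.pi fun _ : Fin n => gaussianReal 0 1)
    (measurable_coneThreshold t n)
  simp only [measureReal_def] at h
  have ha : 0 < Real.sqrt ((n + 1 : ℕ) : ℝ) := Real.sqrt_pos.2 (by positivity)
  exact h.comp (Filter.Tendsto.atTop_mul_const ha tendsto_id)

/-- **Strictly decreasing in the drift on `[0, ∞)`** for `t ≠ 0` and `a ≥ 2`. [ours] -/
theorem pi_gaussianReal_student_shift_strictAntiOn {t : ℝ} (ht : t ≠ 0) {n : ℕ} (hn : 1 ≤ n) :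
    StrictAntiOn (fun δ : ℝ => (Measure.pi fun _ : Fin (n + 1) => gaussianReal 0 1).real
      {g : Fin (n + 1) → ℝ | ((n + 1 : ℕ) : ℝ) * ((∑ i, g i) / ((n + 1 : ℕ) : ℝ) + δ) ^ 2
        ≤ t ^ 2 * ((∑ j, (g j - (∑ i, g i) / ((n + 1 : ℕ) : ℝ)) ^ 2) / (((n + 1 : ℕ) : ℝ) - 1))})
      (Ici 0) := by
  intro δ hδ δ' hδ' hlt
  simp only [measureReal_def, pi_gaussianReal_student_shift_eq_prod]
  have ha : 0 < Real.sqrt ((n + 1 : ℕ) : ℝ) := Real.sqrt_pos.2 (by positivity)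
  have e1 : (0 : ℝ) ≤ δ * Real.sqrt ((n + 1 : ℕ) : ℝ) := mul_nonneg (Set.mem_Ici.1 hδ) ha.le
  have e2 : (0 : ℝ) ≤ δ' * Real.sqrt ((n + 1 : ℕ) : ℝ) := mul_nonneg (Set.mem_Ici.1 hδ') ha.le
  have e3 : δ * Real.sqrt ((n + 1 : ℕ) : ℝ) < δ' * Real.sqrt ((n + 1 : ℕ) : ℝ) :=
    mul_lt_mul_of_pos_right hlt ha
  have h := prod_shiftedSection_strictAntiOn (ν := Measure.pi fun _ : Fin n => gaussianReal 0 1)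
    (measurable_coneThreshold t n) (pi_gaussianReal_coneThreshold_pos ht hn)
    (Set.mem_Ici.2 e1) (Set.mem_Ici.2 e2) e3
  simp only [measureReal_def] at h
  exact h

end OneSample

/-! ## §3 Two arms: `{a(ḡ − h̄ + δ)² ≤ t²(s²(g) + s²(h))}` -/

section TwoSample

set_option maxHeartbeats 400000 in
/-- **The drifted two-arm fixed-count event is a shifted cone**: for `a = n + 1` bins per arm with
`n ≥ 1`, every `t` and drift `δ`,
`(N^{⊗a} ⊗ N^{⊗a}){a(ḡ − h̄ + δ)² ≤ t²(s²(g) + s²(h))}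
   = (N(0,1) ⊗ N(0,1)^{⊗2n}){(u, w) | (u + δ√a/√2)² ≤ t² (Σ_k w_k²)/(2n)}`. [ours] -/
theorem pi_gaussianReal_twoSample_student_shift_eq_prod (t δ : ℝ) {n : ℕ} (hn : 1 ≤ n) :
    ((Measure.pi fun _ : Fin (n + 1) => gaussianReal 0 1).prod
        (Measure.pi fun _ : Fin (n + 1) => gaussianReal 0 1))
      {p : (Fin (n + 1) → ℝ) × (Fin (n + 1) → ℝ) |
        ((n + 1 : ℕ) : ℝ) * ((∑ i, p.1 i) / ((n + 1 : ℕ) : ℝ) - (∑ i, p.2 i) / ((n + 1 : ℕ) : ℝ) + δ) ^ 2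
          ≤ t ^ 2 * (((∑ j, (p.1 j - (∑ i, p.1 i) / ((n + 1 : ℕ) : ℝ)) ^ 2) / (((n + 1 : ℕ) : ℝ) - 1))
            + ((∑ j, (p.2 j - (∑ i, p.2 i) / ((n + 1 : ℕ) : ℝ)) ^ 2) / (((n + 1 : ℕ) : ℝ) - 1)))}
      = ((gaussianReal 0 1).prod (Measure.pi fun _ : Fin (n + n) => gaussianReal 0 1))
        {p : ℝ × (Fin (n + n) → ℝ) | (p.1 + δ * Real.sqrt ((n + 1 : ℕ) : ℝ) / Real.sqrt 2) ^ 2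
          ≤ t ^ 2 * (∑ k, p.2 k ^ 2) / ((n + n : ℕ) : ℝ)} := by
  set γ : Measure ℝ := gaussianReal 0 1 with hγ
  set π := Measure.pi fun _ : Fin (n + 1) => γ with hπ
  set O := ((ℝ ∙ ((toLp 2 (fun _ : Fin (n + 1) => (Real.sqrt (Fintype.card (Fin (n + 1))))⁻¹)
      : EuclideanSpace ℝ (Fin (n + 1))) - EuclideanSpace.single 0 (1 : ℝ)))ᗮ).reflection with hO
  set Ψ : (Fin (n + 1) → ℝ) → (Fin (n + 1) → ℝ) := fun z => ofLp (O (toLp 2 z)) with hΨ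
  have hΨmp : MeasurePreserving Ψ π π := by
    have := measurePreserving_helmert_pi (ι := Fin (n + 1)) 0
    rwa [← hO] at this
  have hn0 : (0 : ℝ) < n := by exact_mod_cast hn
  have ha : (0 : ℝ) < ((n + 1 : ℕ) : ℝ) := by positivity
  have ha1 : ((n + 1 : ℕ) : ℝ) - 1 = (n : ℝ) := by push_cast; ring
  have hnn : ((n + n : ℕ) : ℝ) = 2 * (n : ℝ) := by push_cast; ring
  obtain ⟨hhead, htail⟩ := helmert_head_tail n
  rw [← hO] at hhead htail
  set κ : ℝ := δ * Real.sqrt ((n + 1 : ℕ) : ℝ) / Real.sqrt 2 with hκ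
  -- Step 1: preimage under `Ψ × Ψ` of the "difference of heads / tails" event
  set E' : Set ((Fin (n + 1) → ℝ) × (Fin (n + 1) → ℝ)) := {p |
    ((p.1 0 - p.2 0) / Real.sqrt 2 + κ) ^ 2 ≤ t ^ 2 * (∑ j : Fin n, p.1 j.succ ^ 2
      + ∑ j : Fin n, p.2 j.succ ^ 2) / ((n + n : ℕ) : ℝ)} with hE'
  have hE'm : MeasurableSet E' := measurableSet_le (by fun_prop) (by fun_prop)
  have hpre : {p : (Fin (n + 1) → ℝ) × (Fin (n + 1) → ℝ) |
        ((n + 1 : ℕ) : ℝ) * ((∑ i, p.1 i) / ((n + 1 : ℕ) : ℝ) - (∑ i, p.2 i) / ((n + 1 : ℕ) : ℝ) + δ) ^ 2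
          ≤ t ^ 2 * (((∑ j, (p.1 j - (∑ i, p.1 i) / ((n + 1 : ℕ) : ℝ)) ^ 2) / (((n + 1 : ℕ) : ℝ) - 1))
            + ((∑ j, (p.2 j - (∑ i, p.2 i) / ((n + 1 : ℕ) : ℝ)) ^ 2) / (((n + 1 : ℕ) : ℝ) - 1)))}
      = (Prod.map Ψ Ψ) ⁻¹' E' := by
    ext p
    simp only [Set.mem_setOf_eq, Set.mem_preimage, hE', Prod.map_fst, Prod.map_snd]
    rw [show Ψ p.1 0 = _ from hhead p.1, show Ψ p.2 0 = _ from hhead p.2,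
      show ∑ j : Fin n, Ψ p.1 j.succ ^ 2 = _ from htail p.1,
      show ∑ j : Fin n, Ψ p.2 j.succ ^ 2 = _ from htail p.2, ha1, hnn]
    set Sg := ∑ i, p.1 i
    set Sh := ∑ i, p.2 i
    set Rg := ∑ j, (p.1 j - Sg / ((n + 1 : ℕ) : ℝ)) ^ 2
    set Rh := ∑ j, (p.2 j - Sh / ((n + 1 : ℕ) : ℝ)) ^ 2
    have hsa : Real.sqrt ((n + 1 : ℕ) : ℝ) ≠ 0 := (Real.sqrt_pos.2 ha).ne'
    have hs2 : Real.sqrt 2 ≠ 0 := (Real.sqrt_pos.2 (by norm_num : (0:ℝ) < 2)).ne'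
    have key1 : ((Sg / Real.sqrt ((n + 1 : ℕ) : ℝ) - Sh / Real.sqrt ((n + 1 : ℕ) : ℝ)) / Real.sqrt 2 + κ) ^ 2
        = (1 / 2) * (((n + 1 : ℕ) : ℝ) * (Sg / ((n + 1 : ℕ) : ℝ) - Sh / ((n + 1 : ℕ) : ℝ) + δ) ^ 2) := by
      have h1 : (Sg / Real.sqrt ((n + 1 : ℕ) : ℝ) - Sh / Real.sqrt ((n + 1 : ℕ) : ℝ)) / Real.sqrt 2 + κ
          = (Real.sqrt ((n + 1 : ℕ) : ℝ) / Real.sqrt 2)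
            * (Sg / ((n + 1 : ℕ) : ℝ) - Sh / ((n + 1 : ℕ) : ℝ) + δ) := by
        rw [hκ]
        field_simp
        rw [Real.sq_sqrt ha.le]
        ring
      rw [h1, mul_pow, div_pow, Real.sq_sqrt ha.le, Real.sq_sqrt (by norm_num : (0:ℝ) ≤ 2)]
      field_simp
    have key2 : t ^ 2 * (Rg + Rh) / (2 * (n : ℝ)) = (1 / 2) * (t ^ 2 * (Rg / (n : ℝ) + Rh / (n : ℝ))) := by
      field_simp
    rw [key1, key2]
    constructor <;> intro h <;> linarith
  rw [hpre, ← Measure.map_apply (hΨmp.measurable.prodMap hΨmp.measurable) hE'm,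
    (hΨmp.prod hΨmp).map_eq]
  -- Step 2: one product Gaussian over `Fin (n+1) ⊕ Fin (n+1)`
  set π' := Measure.pi fun _ : Fin (n + 1) ⊕ Fin (n + 1) => γ with hπ'
  have hσ : MeasurePreserving (MeasurableEquiv.sumPiEquivProdPi fun _ : Fin (n + 1) ⊕ Fin (n + 1) => ℝ)
      π' (π.prod π) := measurePreserving_sumPiEquivProdPi fun _ : Fin (n + 1) ⊕ Fin (n + 1) => γ
  rw [← hσ.map_eq, Measure.map_apply (MeasurableEquiv.measurable _) hE'm]
  -- Step 3: the pulled-back event is `(U, V) ⁻¹' B`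
  set ιe : Fin (n + n) → Fin (n + 1) ⊕ Fin (n + 1) :=
    fun k => Sum.map Fin.succ Fin.succ (finSumFinEquiv.symm k) with hιe
  set UV : (Fin (n + 1) ⊕ Fin (n + 1) → ℝ) → ℝ × (Fin (n + n) → ℝ) := fun x =>
    ((x (Sum.inl 0) - x (Sum.inr 0)) / Real.sqrt 2, fun k => x (ιe k)) with hUV
  set B : Set (ℝ × (Fin (n + n) → ℝ)) :=
    {p | (p.1 + κ) ^ 2 ≤ t ^ 2 * (∑ k, p.2 k ^ 2) / ((n + n : ℕ) : ℝ)} with hB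
  have hBm : MeasurableSet B := measurableSet_le (by fun_prop) (by fun_prop)
  have hUVm : Measurable UV := by fun_prop
  have hsumV : ∀ x : Fin (n + 1) ⊕ Fin (n + 1) → ℝ, ∑ k, x (ιe k) ^ 2
      = ∑ j : Fin n, x (Sum.inl j.succ) ^ 2 + ∑ j : Fin n, x (Sum.inr j.succ) ^ 2 := by
    intro x
    rw [hιe, Equiv.sum_comp finSumFinEquiv.symm
      (fun s : Fin n ⊕ Fin n => x (Sum.map Fin.succ Fin.succ s) ^ 2), Fintype.sum_sum_type]
    simp
  have hpre2 : (MeasurableEquiv.sumPiEquivProdPi fun _ : Fin (n + 1) ⊕ Fin (n + 1) => ℝ) ⁻¹' E'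
      = UV ⁻¹' B := by
    ext x
    simp only [hE', hB, hUV, Set.mem_preimage, Set.mem_setOf_eq,
      MeasurableEquiv.coe_sumPiEquivProdPi, Equiv.sumPiEquivProdPi, Equiv.coe_fn_mk, hsumV]
  rw [hpre2, ← Measure.map_apply hUVm hBm, hUV, hιe, pi_sum_gaussianReal_map_diffHead_tails n]

/-- **Monotone in the drift (two arms)**: `δ ↦ (N^{⊗a} ⊗ N^{⊗a}){a(ḡ − h̄ + δ)² ≤ t²(s²(g) + s²(h))}`
is non-increasing on `[0, ∞)` (`a ≥ 2`). [ours] -/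
theorem pi_gaussianReal_twoSample_student_shift_antitoneOn (t : ℝ) {n : ℕ} (hn : 1 ≤ n) :
    AntitoneOn (fun δ : ℝ => ((Measure.pi fun _ : Fin (n + 1) => gaussianReal 0 1).prod
        (Measure.pi fun _ : Fin (n + 1) => gaussianReal 0 1)).real
      {p : (Fin (n + 1) → ℝ) × (Fin (n + 1) → ℝ) |
        ((n + 1 : ℕ) : ℝ) * ((∑ i, p.1 i) / ((n + 1 : ℕ) : ℝ) - (∑ i, p.2 i) / ((n + 1 : ℕ) : ℝ) + δ) ^ 2
          ≤ t ^ 2 * (((∑ j, (p.1 j - (∑ i, p.1 i) / ((n + 1 : ℕ) : ℝ)) ^ 2) / (((n + 1 : ℕ) : ℝ) - 1))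
            + ((∑ j, (p.2 j - (∑ i, p.2 i) / ((n + 1 : ℕ) : ℝ)) ^ 2) / (((n + 1 : ℕ) : ℝ) - 1)))})
      (Ici 0) := by
  intro δ hδ δ' hδ' hle
  simp only [measureReal_def, pi_gaussianReal_twoSample_student_shift_eq_prod t _ hn]
  have hc : 0 ≤ Real.sqrt ((n + 1 : ℕ) : ℝ) / Real.sqrt 2 := by positivity
  have e1 : (0 : ℝ) ≤ δ * Real.sqrt ((n + 1 : ℕ) : ℝ) / Real.sqrt 2 := by
    rw [mul_div_assoc]; exact mul_nonneg (Set.mem_Ici.1 hδ) hc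
  have e2 : (0 : ℝ) ≤ δ' * Real.sqrt ((n + 1 : ℕ) : ℝ) / Real.sqrt 2 := by
    rw [mul_div_assoc]; exact mul_nonneg (Set.mem_Ici.1 hδ') hc
  have e3 : δ * Real.sqrt ((n + 1 : ℕ) : ℝ) / Real.sqrt 2 ≤ δ' * Real.sqrt ((n + 1 : ℕ) : ℝ) / Real.sqrt 2 := by
    rw [mul_div_assoc, mul_div_assoc]; exact mul_le_mul_of_nonneg_right hle hc
  have h := prod_shiftedSection_antitoneOn (ν := Measure.pi fun _ : Fin (n + n) => gaussianReal 0 1)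
    (measurable_coneThreshold t (n + n)) (Set.mem_Ici.2 e1) (Set.mem_Ici.2 e2) e3
  simp only [measureReal_def] at h
  exact h

/-- **Strictly decreasing in the drift (two arms)** for `t ≠ 0`, `a ≥ 2`. [ours] -/
theorem pi_gaussianReal_twoSample_student_shift_strictAntiOn {t : ℝ} (ht : t ≠ 0) {n : ℕ} (hn : 1 ≤ n) :
    StrictAntiOn (fun δ : ℝ => ((Measure.pi fun _ : Fin (n + 1) => gaussianReal 0 1).prod
        (Measure.pi fun _ : Fin (n + 1) => gaussianReal 0 1)).real
      {p : (Fin (n + 1) → ℝ) × (Fin (n + 1) → ℝ) |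
        ((n + 1 : ℕ) : ℝ) * ((∑ i, p.1 i) / ((n + 1 : ℕ) : ℝ) - (∑ i, p.2 i) / ((n + 1 : ℕ) : ℝ) + δ) ^ 2
          ≤ t ^ 2 * (((∑ j, (p.1 j - (∑ i, p.1 i) / ((n + 1 : ℕ) : ℝ)) ^ 2) / (((n + 1 : ℕ) : ℝ) - 1))
            + ((∑ j, (p.2 j - (∑ i, p.2 i) / ((n + 1 : ℕ) : ℝ)) ^ 2) / (((n + 1 : ℕ) : ℝ) - 1)))})
      (Ici 0) := by
  intro δ hδ δ' hδ' hlt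
  simp only [measureReal_def, pi_gaussianReal_twoSample_student_shift_eq_prod t _ hn]
  have hc : 0 < Real.sqrt ((n + 1 : ℕ) : ℝ) / Real.sqrt 2 := by positivity
  have hpos := pi_gaussianReal_coneThreshold_pos ht (show 1 ≤ n + n by omega)
  have e1 : (0 : ℝ) ≤ δ * Real.sqrt ((n + 1 : ℕ) : ℝ) / Real.sqrt 2 := by
    rw [mul_div_assoc]; exact mul_nonneg (Set.mem_Ici.1 hδ) hc.le
  have e2 : (0 : ℝ) ≤ δ' * Real.sqrt ((n + 1 : ℕ) : ℝ) / Real.sqrt 2 := by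
    rw [mul_div_assoc]; exact mul_nonneg (Set.mem_Ici.1 hδ') hc.le
  have e3 : δ * Real.sqrt ((n + 1 : ℕ) : ℝ) / Real.sqrt 2 < δ' * Real.sqrt ((n + 1 : ℕ) : ℝ) / Real.sqrt 2 := by
    rw [mul_div_assoc, mul_div_assoc]; exact mul_lt_mul_of_pos_right hlt hc
  have h := prod_shiftedSection_strictAntiOn (ν := Measure.pi fun _ : Fin (n + n) => gaussianReal 0 1)
    (measurable_coneThreshold t (n + n)) hpos (Set.mem_Ici.2 e1) (Set.mem_Ici.2 e2) e3
  simp only [measureReal_def] at h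
  exact h

end TwoSample

end Summit.Ventures.LatticeQCDFlow.Scoring
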